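import Literature.AnabelianGeometry.SemiGraphs.TemperedSpecialFibreTowerPiDataNonVacuity
import Literature.AnabelianGeometry.SemiGraphs.TemperedCurveGroupLevelDataNonVacuity2
import Literature.AnabelianGeometry.SemiGraphs.TemperedSpecialFibreTowerNonVacuity
import HarnessLib

/-!
# A §6 datum with genuine arithmetic part carrying `SpecialFibreTower.PiData` — non-vacuity witness
# ([SemiAnbd] Ex. 3.10 pp. 44–45, §6 pp. 69–71; [IUTchI] §2 pp. 44–50)

Mochizuki, *Semi-graphs of anabelioids*, Publ. RIMS **42** (2006), §3 Example 3.10 p. 44 ("`1 → Δ → Π → G_K → 1` …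
an exhaustive sequence of open characteristic … subgroups … `N_i` … `𝒢_i`, `𝒢^c_i` on which `Δ_i` acts") and §6
pp. 69–71 (the interface `TemperedCurve p`) [cite: MochizukiSemiAnbd2006, Ex 3.10 p.44]; S. Mochizuki,
*Inter-universal Teichmüller theory I*, §2 pp. 44–50 [cite: Mochizuki2012, Prop 2.4(i) p.50] — the ORIGIN-DATA records
`SpecialFibreTower.PiData X d S T` / `FiniteLevels X d S T` of seat abc-iut-L3-t2 gen 3 (`TemperedSpecialFibreTowerPiData.lean`).

PROOF-ONLY file (abc-iut cell §4(iii) non-vacuity lane, row «NV-L3 PiData + FiniteLevels»; seat abc-iut-L3-t2 gen 4;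
no definition, no instance, no named fact).  `PiData` is a record over a §6 datum `X : TemperedCurve p` with the
parameter bundle `d : X.GroupLevelData` (genuine `G_K ≃ Gal(K̄/K)`, temperedness, slimness, Galois-countability) —
so a kernel inhabitant needs a `TemperedCurve` whose `Π^temp` is slim with `G_K ≠ 1` AND whose `Δ^temp` carries a
special-fibre tower.  Following seat abc-iut-w5-d040's `TemperedCurveGroupLevelDataNonVacuity2.lean` (`Π := G_{ℚ_p} × F̂₂`):

* `SpecialFibreTower.PiData.exists_temperedCurve_of_charLevels` — for EVERY slim infinite second-countable profinite
  group `A` carrying an antitone family of open normal finite-index subgroups stable under all automorphisms of the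
  topological group `A` and cofinal among its open normal finite-index subgroups, the datum `K := ℚ_p`,
  `Π^temp := G_{ℚ_p} × A` (augmentation the first projection, so `G_K = G_{ℚ_p}` GENUINE and `Δ^temp = 1 × A ≅ A`;
  itself as profinite completion; no closed points) carries `GroupLevelData` (`galEquiv := galoisIdentification`;
  slimness of `G_{ℚ_p}` = [pGC] Lem. 15.8 PROVED in the tree, of products = abc-iut-w5-d040; temperedness: profinite;
  Galois-countability: Krasner + second countability of `A`), the transported family is again characteristic and
  cofinal, and `SpecialFibreTower.PiData.nonempty_of_charLevels` (`TemperedSpecialFibreTowerPiDataNonVacuity.lean`)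
  inhabits `FiniteLevels` and `PiData` there;
* `…_padicAffine` — at `A := Aff(ℤ_p)`, `p` odd, with the CONGRUENCE levels `Γ_i` (seat abc-iut-w5-d212's
  `PadicAffine.level_char`: characteristic; cofinal by `PadicAffine.exists_level_le`) — the tower levels ARE the
  transported `Γ_i`;
* `…_of_isTopologicallyFinitelyGenerated` — at every slim infinite second-countable topologically finitely generated
  profinite `A` (e.g. `F̂₂`), with the characteristic open cores of seat abc-iut-w4-d053;
* `SpecialFibreTower.PiData.exists_inhabited` — hence `PiData` is inhabited outright (`p = 3`, `A = Aff(ℤ_3)`).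

HONEST LIMITS: consistency evidence for the field sets of `PiData` / `FiniteLevels` (and of everything they sit over:
`TemperedCurve`, `GroupLevelData`, `SpecialFibreData`, `SpecialFibreTower`) only — `Π^temp` is a direct product and
profinite, there are no closed points (the cusp items (P3) are vacuous here), the fibres are one-vertex semi-graphs of
anabelioids, the graph actions are trivial; NOT André's `π₁^temp` of a curve and NOT the special-fibre tower of a
curve; no origin certificate is claimed.  Nothing of the papers is asserted; no side is taken on [IUTchIII] Cor. 3.12.
-/

noncomputable section

namespace Literature.AnabelianGeometry.SemiGraphs

open Literature.AlgebraicGeometry.Frobenioids (IsSlimGroup)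
open Literature.AnabelianGeometry.AbsoluteAnabelian
open Literature.GroupTheory.SpecificGroups
open ProfiniteSemiGraph Topology

/-! ### Transport bookkeeping (private) -/

/-- Slimness is transported along isomorphisms of topological groups. [cite: MochizukiSemiAnbd2006, §0 p.6] -/
private theorem isSlimGroup_transport_witnessAux {G₁ G₂ : Type*} [Group G₁] [TopologicalSpace G₁]
    [Group G₂] [TopologicalSpace G₂] (e : G₁ ≃ₜ* G₂) (h : IsSlimGroup G₁) : IsSlimGroup G₂ := by
  refine ⟨fun H hH => ?_⟩
  refine (Subgroup.eq_bot_iff_forall _).mpr fun z hz => ?_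
  have hH' : IsOpen ((H.comap e.toMulEquiv.toMonoidHom : Subgroup G₁) : Set G₁) :=
    hH.preimage e.continuous
  have hz' : e.symm z ∈ Subgroup.centralizer ((H.comap e.toMulEquiv.toMonoidHom : Subgroup G₁) : Set G₁) := by
    refine Subgroup.mem_centralizer_iff.mpr fun g hg => ?_
    have := Subgroup.mem_centralizer_iff.mp hz (e g) hg
    apply e.injective
    simpa [map_mul] using this
  rw [h.centralizer_eq_bot _ hH'] at hz'
  have : e.symm z = 1 := Subgroup.mem_bot.mp hz'
  simpa using congrArg e this

/-- The subgroup `1 × A ≤ G × A` (given by the membership condition `x.1 = 1`) is `A` as a topological group.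
[cite: MochizukiSemiAnbd2006, §6 p.69] -/
private theorem nonempty_continuousMulEquiv_of_fst_eq_one {G A : Type*} [Group G] [TopologicalSpace G]
    [Group A] [TopologicalSpace A] (H : Subgroup (G × A)) (hH : ∀ x, x ∈ H ↔ x.1 = 1) :
    Nonempty (A ≃ₜ* H) :=
  ⟨{ toFun := fun z => ⟨(1, z), (hH _).2 rfl⟩
     invFun := fun y => y.1.2
     left_inv := fun z => rfl
     right_inv := fun y => by
       apply Subtype.ext
       exact Prod.ext ((hH _).1 y.2).symm rfl
     map_mul' := fun z w => Subtype.ext (Prod.ext (by simp) rfl)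
     continuous_toFun := (continuous_const.prodMk continuous_id).subtype_mk _
     continuous_invFun := continuous_snd.comp continuous_subtype_val }⟩

/-- Antitone characteristic cofinal families of open normal finite-index subgroups are transported along isomorphisms
of topological groups (image family). [cite: MochizukiSemiAnbd2006, Ex 3.10 p.44] -/
private theorem charLevels_map {A B : Type*} [Group A] [TopologicalSpace A] [Group B] [TopologicalSpace B]
    (e : A ≃ₜ* B) (M : ℕ → Subgroup A) (hanti : Antitone M) (hopen : ∀ i, IsOpen (M i : Set A))
    (hchar : ∀ (i) (φ : A ≃ₜ* A), (M i).map φ.toMulEquiv.toMonoidHom = M i) (hnormal : ∀ i, (M i).Normal)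
    (hfi : ∀ i, (M i).FiniteIndex)
    (hcof : ∀ U : Subgroup A, IsOpen (U : Set A) → U.Normal → U.FiniteIndex → ∃ i, M i ≤ U) :
    Antitone (fun i => (M i).map e.toMulEquiv.toMonoidHom) ∧
      (∀ i, IsOpen (((M i).map e.toMulEquiv.toMonoidHom : Subgroup B) : Set B)) ∧
      (∀ (i) (φ : B ≃ₜ* B), ((M i).map e.toMulEquiv.toMonoidHom).map φ.toMulEquiv.toMonoidHom =
        (M i).map e.toMulEquiv.toMonoidHom) ∧
      (∀ i, ((M i).map e.toMulEquiv.toMonoidHom).Normal) ∧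
      (∀ i, ((M i).map e.toMulEquiv.toMonoidHom).FiniteIndex) ∧
      ∀ U : Subgroup B, IsOpen (U : Set B) → U.Normal → U.FiniteIndex →
        ∃ i, (M i).map e.toMulEquiv.toMonoidHom ≤ U := by
  refine ⟨fun i j hij => Subgroup.map_mono (hanti hij), fun i => ?_, fun i φ => ?_, fun i => ?_, fun i => ?_,
    fun U hU hUn hUf => ?_⟩
  · rw [Subgroup.coe_map]
    exact e.toHomeomorph.isOpenMap _ (hopen i)
  · -- conjugate `φ` back to `A`
    let ψ : A ≃ₜ* A := e.trans (φ.trans e.symm)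
    have hcomp : e.toMulEquiv.toMonoidHom.comp ψ.toMulEquiv.toMonoidHom =
        φ.toMulEquiv.toMonoidHom.comp e.toMulEquiv.toMonoidHom :=
      MonoidHom.ext fun a => e.apply_symm_apply (φ (e a))
    calc ((M i).map e.toMulEquiv.toMonoidHom).map φ.toMulEquiv.toMonoidHom
        = (M i).map (φ.toMulEquiv.toMonoidHom.comp e.toMulEquiv.toMonoidHom) := Subgroup.map_map _ _ _
      _ = (M i).map (e.toMulEquiv.toMonoidHom.comp ψ.toMulEquiv.toMonoidHom) := by rw [hcomp]
      _ = ((M i).map ψ.toMulEquiv.toMonoidHom).map e.toMulEquiv.toMonoidHom := (Subgroup.map_map _ _ _).symm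
      _ = (M i).map e.toMulEquiv.toMonoidHom := by rw [hchar i ψ]
  · exact (hnormal i).map _ e.surjective
  · have hidx : ((M i).map e.toMulEquiv.toMonoidHom).index = (M i).index :=
      Subgroup.index_map_of_bijective (f := e.toMulEquiv.toMonoidHom) e.bijective (M i)
    exact ⟨by rw [hidx]; exact (hfi i).index_ne_zero⟩
  · have hU' : IsOpen ((U.comap e.toMulEquiv.toMonoidHom : Subgroup A) : Set A) := hU.preimage e.continuous
    haveI : (U.comap e.toMulEquiv.toMonoidHom).Normal := hUn.comap _
    have hidx : (U.comap e.toMulEquiv.toMonoidHom).index = U.index :=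
      U.index_comap_of_surjective (f := e.toMulEquiv.toMonoidHom) e.surjective
    haveI : (U.comap e.toMulEquiv.toMonoidHom).FiniteIndex := ⟨by rw [hidx]; exact hUf.index_ne_zero⟩
    obtain ⟨i, hi⟩ := hcof _ hU' inferInstance inferInstance
    exact ⟨i, Subgroup.map_le_iff_le_comap.mpr hi⟩

/-! ### The witness over an arbitrary geometric factor `A` -/

namespace SpecialFibreTower

variable (p : ℕ) [Fact p.Prime]

/-- **`SpecialFibreTower.PiData` (and `FiniteLevels`, `GroupLevelData`) INHABITED at the §6 datum
`Π^temp := G_{ℚ_p} × A`** for EVERY slim infinite second-countable profinite `A` with an antitone family `M` of open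
normal finite-index subgroups stable under all automorphisms of the topological group `A` and cofinal among the open
normal finite-index subgroups: `K := ℚ_p` (so `G_K = G_{ℚ_p}`, `aug` ONTO it), `Δ^temp = 1 × A ≅ A`, no closed
points; `GroupLevelData` unconditionally; the tower levels are the transported `M_i`, the fibres one-vertex
semi-graphs of anabelioids, the admissible kernels `1` (via `PiData.nonempty_of_charLevels`).  Consistency evidence only.
[cite: MochizukiSemiAnbd2006, Ex 3.10 p.44] -/
theorem PiData.exists_temperedCurve_of_charLevels (A : Type) [Group A] [TopologicalSpace A]
    [IsTopologicalGroup A] [CompactSpace A] [TotallyDisconnectedSpace A] [SecondCountableTopology A] [Infinite A]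
    (hslim : IsSlimGroup A) (M : ℕ → Subgroup A) (hanti : Antitone M) (hopen : ∀ i, IsOpen (M i : Set A))
    (hchar : ∀ (i) (φ : A ≃ₜ* A), (M i).map φ.toMulEquiv.toMonoidHom = M i) (hnormal : ∀ i, (M i).Normal)
    (hfi : ∀ i, (M i).FiniteIndex)
    (hcof : ∀ U : Subgroup A, IsOpen (U : Set A) → U.Normal → U.FiniteIndex → ∃ i, M i ≤ U) :
    ∃ (X : TemperedCurve p) (d : X.GroupLevelData) (S : SpecialFibreData (X.toTemperedArithmeticGroup d))
      (T : SpecialFibreTower X.DeltaTemp),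
      X.K = ⊥ ∧ Function.Surjective X.aug ∧ IsEmpty X.Pt ∧
        (∃ e : A ≃ₜ* X.DeltaTemp, ∀ i, T.N i = (M i).map e.toMulEquiv.toMonoidHom) ∧
        (∀ i, T.admKer i = ⊥) ∧ FiniteLevels X d S T ∧ Nonempty (PiData X d S T) := by
  classical
  haveI : IsGalois ℚ_[p] (AlgebraicClosure ℚ_[p]) := {}
  haveI : T2Space (GQp p) := krullTopology_t2
  let fstH : GQp p × A →ₜ* GQp p := ContinuousMonoidHom.fst _ _
  -- the §6 datum `Π^temp := G_{ℚ_p} × A`, no closed points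
  let X : TemperedCurve p :=
    { K := ⊥
      finiteDimensional_K := inferInstance
      PiTemp := GQp p × A
      aug := fstH
      range_aug := by
        rw [IntermediateField.fixingSubgroup_bot]
        exact MonoidHom.range_eq_top.mpr Prod.fst_surjective
      PiHat := GQp p × A
      toHat := ContinuousMonoidHom.id _
      isProfiniteCompletion_toHat := isProfiniteCompletion_id _
      toHat_injective := Function.injective_id
      augHat := fstH
      augHat_comp := fun _ => rfl
      Pt := PEmpty
      IsCusp := fun x => x.elim
      decomp := fun x => x.elim
      isClosed_decomp := fun x => x.elim
      isOpen_aug_decomp := fun x => x.elim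
      inertia_eq_bot := fun x => x.elim
      inertia_equiv_zHat := fun x => x.elim }
  -- group-level facts about `Π = G_{ℚ_p} × A`
  have hT : IsTempered (GQp p × A) := IsTempered.of_profinite
  have hslimG : IsSlimGroup (GQp p) :=
    IsSubpadicFor.isSlimGroup_absoluteGaloisGroup (AbsTopIII.IsSubpadicFor.padic p)
  have hslimPi : IsSlimGroup (GQp p × A) := isSlimGroup_prod_of_profinite hslimG hslim
  haveI hscG : SecondCountableTopology (GQp p) :=
    Literature.NumberTheory.LocalFields.secondCountableTopology_galQp p
  have hsc : SecondCountableTopology (GQp p × A) := inferInstance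
  -- `Δ^temp = Ker(pr₁) = 1 × A ≃ₜ* A`
  have hΔmem : ∀ x : GQp p × A, x ∈ X.DeltaTemp ↔ x.1 = 1 := fun x => MonoidHom.mem_ker
  obtain ⟨e⟩ := nonempty_continuousMulEquiv_of_fst_eq_one X.DeltaTemp hΔmem
  -- the parameter bundle
  let ιG := X.galoisIdentification
  have hkermem : ∀ x : GQp p × A, x ∈ (X.augK ιG).toMonoidHom.ker ↔ x.1 = 1 := fun x => by
    rw [TemperedCurve.ker_augK]; exact hΔmem x
  have hkerClosed : IsClosed (((X.augK ιG).toMonoidHom.ker : Subgroup (GQp p × A)) : Set (GQp p × A)) := by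
    have : (((X.augK ιG).toMonoidHom.ker : Subgroup (GQp p × A)) : Set (GQp p × A)) = Prod.fst ⁻¹' {1} := by
      ext x; exact hkermem x
    rw [this]; exact isClosed_singleton.preimage continuous_fst
  have hslimKer : IsSlimGroup (X.augK ιG).toMonoidHom.ker := by
    obtain ⟨eK⟩ := nonempty_continuousMulEquiv_of_fst_eq_one _ hkermem
    exact isSlimGroup_transport_witnessAux eK hslim
  let d : X.GroupLevelData :=
    { galEquiv := ιG
      isTempered := hT
      isTempered_ker := hT.subgroup_of_isClosed _ hkerClosed
      isSlimGroup := hslimPi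
      isSlimGroup_ker := hslimKer
      secondCountableTopology := hsc }
  -- the transported levels on `Δ^temp`
  obtain ⟨hNanti, hNopen, hNchar, hNnormal, hNfi, hNcof⟩ := charLevels_map e M hanti hopen hchar hnormal hfi hcof
  have hinf : Infinite X.DeltaTemp := Infinite.of_injective e e.injective
  haveI : CompactSpace X.PiTemp := (inferInstance : CompactSpace (GQp p × A))
  haveI : TotallyDisconnectedSpace X.PiTemp := (inferInstance : TotallyDisconnectedSpace (GQp p × A))
  obtain ⟨S, T, hTN, hadm, -, hF, hP⟩ := PiData.nonempty_of_charLevels X d hinf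
    (fun i => (M i).map e.toMulEquiv.toMonoidHom) hNanti hNopen hNchar hNnormal hNfi hNcof
  exact ⟨X, d, S, T, rfl, Prod.fst_surjective, (inferInstance : IsEmpty PEmpty), ⟨e, fun i => by rw [hTN]⟩,
    hadm, hF, hP⟩

/-! ### At `A := Aff(ℤ_p)` with the congruence levels -/

/-- `Aff(ℤ_p)` is infinite: `[Aff(ℤ_p) : Γ_n] ≥ p^n` is unbounded. [cite: MochizukiSemiAnbd2006, §0 p.6] -/
private theorem infinite_padicAffine : Infinite (PadicAffine p) := by
  refine ⟨fun hfin => ?_⟩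
  have h1 := PadicAffine.pow_le_card_quotient_level (p := p) (Nat.card (PadicAffine p))
  have h2 : Nat.card (PadicAffine p ⧸ PadicAffine.level p (Nat.card (PadicAffine p))) ≤ Nat.card (PadicAffine p) :=
    Nat.card_le_card_of_surjective _ (QuotientGroup.mk_surjective)
  have h3 : Nat.card (PadicAffine p) < p ^ Nat.card (PadicAffine p) :=
    Nat.lt_pow_self (Fact.out : p.Prime).one_lt
  omega

/-- **`SpecialFibreTower.PiData` INHABITED at `Π^temp := G_{ℚ_p} × Aff(ℤ_p)`, `p` odd**, with the GENUINE
[SemiAnbd] ingredients of seat abc-iut-L3-t2 gen 3's tower witness at every level: the levels are the (transported)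
CONGRUENCE subgroups `Γ_i` of `Aff(ℤ_p)` (open, normal, finite index, CHARACTERISTIC for odd `p` — seat
abc-iut-w5-d212's `PadicAffine.level_char` —, cofinal among the open subgroups), the fibres the one-vertex semi-graphs
of anabelioids `B(Γ_i)`, `π₁^temp = Γ_i`, admissible kernels `1`, faithfulness = slimness of `Aff(ℤ_p)`; arithmetic
part GENUINE (`G_K = G_{ℚ_p}`).  Consistency evidence only. [cite: MochizukiSemiAnbd2006, Ex 3.10 p.44] -/
theorem PiData.exists_temperedCurve_padicAffine (hp : p ≠ 2) :
    ∃ (X : TemperedCurve p) (d : X.GroupLevelData) (S : SpecialFibreData (X.toTemperedArithmeticGroup d))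
      (T : SpecialFibreTower X.DeltaTemp),
      X.K = ⊥ ∧ Function.Surjective X.aug ∧ IsEmpty X.Pt ∧
        (∃ e : PadicAffine p ≃ₜ* X.DeltaTemp, ∀ i, T.N i = (PadicAffine.level p i).map e.toMulEquiv.toMonoidHom) ∧
        (∀ i, T.admKer i = ⊥) ∧ FiniteLevels X d S T ∧ Nonempty (PiData X d S T) := by
  haveI : SecondCountableTopology (PadicAffine p) := secondCountableTopology_padicAffine
  haveI : Infinite (PadicAffine p) := infinite_padicAffine p
  exact PiData.exists_temperedCurve_of_charLevels p (PadicAffine p) ⟨PadicAffine.centralizer_eq_bot_of_isOpen⟩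
    (PadicAffine.level p) SpecialFibreTowerWitness.level_antitone PadicAffine.isOpen_level
    (PadicAffine.level_char hp) (fun i => inferInstance) (fun i => SpecialFibreTowerWitness.finiteIndex_level i)
    (fun U hU _ _ => by
      obtain ⟨n, -, h⟩ := PadicAffine.exists_level_le U hU
      exact ⟨n, h⟩)

/-! ### At topologically finitely generated `A` with the characteristic open cores -/

/-- **`SpecialFibreTower.PiData` INHABITED at `Π^temp := G_{ℚ_p} × A` for every slim infinite second-countable
TOPOLOGICALLY FINITELY GENERATED profinite `A`** (e.g. `F̂₂`), the levels being the (transported) characteristic open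
cores `charOpenCore A i` of seat abc-iut-w4-d053 (cofinal among the open subgroups of finite index).  Consistency
evidence only. [cite: MochizukiSemiAnbd2006, Ex 3.10 p.44] -/
theorem PiData.exists_temperedCurve_of_isTopologicallyFinitelyGenerated (A : Type) [Group A] [TopologicalSpace A]
    [IsTopologicalGroup A] [CompactSpace A] [TotallyDisconnectedSpace A] [SecondCountableTopology A] [Infinite A]
    (hslim : IsSlimGroup A) (htfg : IsTopologicallyFinitelyGenerated A) :
    ∃ (X : TemperedCurve p) (d : X.GroupLevelData) (S : SpecialFibreData (X.toTemperedArithmeticGroup d))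
      (T : SpecialFibreTower X.DeltaTemp),
      X.K = ⊥ ∧ Function.Surjective X.aug ∧ IsEmpty X.Pt ∧
        (∃ e : A ≃ₜ* X.DeltaTemp, ∀ i, T.N i = (charOpenCore A i).map e.toMulEquiv.toMonoidHom) ∧
        (∀ i, T.admKer i = ⊥) ∧ FiniteLevels X d S T ∧ Nonempty (PiData X d S T) := by
  obtain ⟨hanti, hlev, hcof⟩ := charOpenCore_family_of_tfg (Γ := A) htfg
  exact PiData.exists_temperedCurve_of_charLevels p A hslim (charOpenCore A) hanti (fun i => (hlev i).1)
    (fun i φ => (hlev i).2.2.2 φ.toMulEquiv φ.continuous φ.symm.continuous) (fun i => (hlev i).2.1)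
    (fun i => (hlev i).2.2.1) (fun U hU _ hUf => hcof U hU hUf)

end SpecialFibreTower

/-! ### Outright inhabitation -/

/-- **The origin-data record `SpecialFibreTower.PiData` is inhabited** (at `p = 3`, `Π^temp := G_{ℚ_3} × Aff(ℤ_3)`):
its 25 fields — and those of `FiniteLevels`, `SpecialFibreTower`, `SpecialFibreData`, `GroupLevelData`,
`TemperedCurve` underneath — are jointly satisfiable.  Consistency evidence only; not the tower of a curve.
[cite: MochizukiSemiAnbd2006, Ex 3.10 p.44] -/
theorem SpecialFibreTower.PiData.exists_inhabited :
    ∃ (p : ℕ) (_ : Fact p.Prime) (X : TemperedCurve p) (d : X.GroupLevelData)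
      (S : SpecialFibreData (X.toTemperedArithmeticGroup d)) (T : SpecialFibreTower X.DeltaTemp),
      FiniteLevels X d S T ∧ Nonempty (SpecialFibreTower.PiData X d S T) := by
  obtain ⟨X, d, S, T, -, -, -, -, -, hF, hP⟩ :=
    @SpecialFibreTower.PiData.exists_temperedCurve_padicAffine 3 ⟨Nat.prime_three⟩ (by decide)
  exact ⟨3, ⟨Nat.prime_three⟩, X, d, S, T, hF, hP⟩

end Literature.AnabelianGeometry.SemiGraphs

end
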